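import Literature.RingTheory.Henselian.FiniteAlgebraProductOfLocalizations
import Literature.RingTheory.Henselian.FiniteLocalAlgebraTensorProduct
import Literature.AlgebraicGeometry.GroupSchemes.SubgroupSchemeOfSubgroupIdeal
import Literature.AlgebraicGeometry.AbelianSchemes.AbelianSchemeLocalRelDim
import Mathlib.AlgebraicGeometry.Morphisms.Finite
import Mathlib.AlgebraicGeometry.Morphisms.ClosedImmersion
import Mathlib.RingTheory.Henselian
import HarnessLib

/-!
# The unit component of a finite group scheme over a henselian local ring: the clopen `D(e)` through the unit section is a
# connected open-and-closed subgroup scheme ([Tate1997FiniteFlatGroupSchemes] (3.7) (I); [StacksProject] Tag 04GG)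

Topic `Literature/AlgebraicGeometry/GroupSchemes`; namespace `Literature.AlgebraicGeometry.GroupSchemes.UnitComponentClopen`.  PROOF FILE
(theorems only: no definition, no instance, no notation, no named fact, no `sorry`).  Cell `hodgecm-mathlib` (D-0151), FLOOR 0, P6
«MOD programme», sub-line `Cruxes/HLiu418/Lines/F0_P6b_ConnectedEtale.lean` ED. 1 (F0P6b-plan (g0); ref1 BOX P6b-4 GREEN), stub
`stub_b1a_unitComponent` — road σ2 «CLOPEN `D(e)` + FUNCTOR OF POINTS» (F0P6-p13): NO Hopf algebra is used.  `--supports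
stmt-HodgeConjecture-24832`; count-neutral: HC_CM is proved only modulo the printed citations until rung 0 closes, and nothing here bears on it.

THE PRINT.  [Tate1997FiniteFlatGroupSchemes] (3.7) (I): for a finite group scheme `G = Spec B` over a henselian local ring `R`, `B` is a
finite product of local rings, the factor `B⁰` through which the counit factors has residue field `κ(R)`, `G⁰ := Spec B⁰` is open and
closed in `G`, and «`G_i ×_S G⁰` is connected … in particular `G⁰ G⁰ = G⁰`» (proof, item 2), pp. 141–142: a tensor product of finite local `R`-algebras one
of which has trivial residue extension is local), so that `G⁰` is a (closed, open, connected) subgroup scheme — the UNIT COMPONENT.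
[StacksProject] Tag 04GG (10): finite algebras over henselian local rings are finite products of local rings.

THE ROAD (scheme currency, `G : Over (Spec R)` with `[GrpObj G]`, Mathlib's cartesian-monoidal `Over`; NO flatness used):
§1 `exists_grpObj_isMonHom_of_subset` — for ANY `S`-group scheme and an open `V ⊆ G.left` into which the unit section, `V ≫ ι` and
`(V ×_S V) ≫ μ` land SET-THEORETICALLY, `Over.mk (V.ι ≫ G.hom)` is a group object with `Over.homMk V.ι` a homomorphism (Mathlib
`IsOpenImmersion.lift` + ★ `GroupSchemes.exists_grpObj_isMonHom_of_lifts`).  §2 morphisms from `Spec` of a local ring, resp. from a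
connected scheme, land in opens through the closed point, resp. in clopens they meet.  §3 `D(e)` is clopen for an idempotent `e`;
**`exists_isIdempotentElem`**: for `G` FINITE over a HENSELIAN local `R` an idempotent `e ∈ Γ(G, 𝒪_G)` with the unit point in `D(e)` and
LOCAL corner `Γ(G, 𝒪_G) ⧸ (1 - e)` (★ `Henselian.exists_completeOrthogonalIdempotents_isLocalRing`; the counit of a complete orthogonal family
sums to `1`, so one member is a unit of `R`).  §4 `Γ(D(e))` is that corner (Mathlib `IsLocalization.away_of_isIdempotentElem`), so `D(e)` is
CONNECTED (★ `Morphisms.connectedSpace_Spec_of_isLocalRing`), and **`connectedSpace_pullback`**: `D(e) ×_R D(e) ≅ Spec (Γ(D(e)) ⊗_R Γ(D(e)))`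
(Mathlib `pullbackSpecIso`) is CONNECTED — Tate's item 2) = ★ `Henselian.isLocalRing_tensorProduct` (residue field generated by `R` via the
section `η`; non-trivial via `η ⊗ η`).  §5 **`exists_unitComponent`** = stub `stub_b1a_unitComponent` with `IsUnitComponent` unfolded
binder for binder (`G₀ = D(e)`, `j = D(e) ↪ G`: homomorphism, open and closed immersion, connected source).

## References
* [Tate1997FiniteFlatGroupSchemes] J. Tate, *Finite flat group schemes*, in: G. Cornell, J. H. Silverman, G. Stevens (eds.), *Modular Forms
  and Fermat's Last Theorem* (Springer 1997), (3.7) «The connected–étale exact sequence over a Henselian local ring», part (I) and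
  item 2) of its proof (pp. 141–142).
* [StacksProject] The Stacks Project, Tag 04GG (Algebra, Lemma 10.153.3 (10)): a finite algebra over a henselian local ring is a finite
  product of local rings; Tag 00EE (idempotents and clopen subsets of the spectrum).
-/

noncomputable section

set_option backward.isDefEq.respectTransparency false

universe u

open CategoryTheory CategoryTheory.Limits AlgebraicGeometry MonoidalCategory CartesianMonoidalCategory
open scoped MonObj TensorProduct

namespace Literature.AlgebraicGeometry.GroupSchemes.UnitComponentClopen

/-! ## §1 An open subscheme through which the unit, the inversion and the multiplication factor is a subgroup scheme -/

section Opens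

variable {S : Scheme.{u}} (G : Over S) [GrpObj G] (V : G.left.Opens)

/-- **An open piece of a group scheme stable under the structure maps is an open subgroup scheme.**  Let `G` be a group object of
`Over S` and `V ⊆ G.left` an open subset such that the unit section `η`, the composite `V ↪ G →ι G` and the composite
`V ×_S V ↪ G ×_S G →μ G` all LAND IN `V` set-theoretically.  Then the open subscheme `G₀ := (V → S)` carries a group-object structure
for which the open immersion `j : G₀ ⟶ G` is a homomorphism (the three structure maps lift through the open immersion `V.ι`, Mathlib
`IsOpenImmersion.lift`, and a monomorphism through which `μ, η, ι` lift is a subgroup object, ★ `exists_grpObj_isMonHom_of_lifts`).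
[cite: Tate1997FiniteFlatGroupSchemes, (3.7) (I)] [cite: StacksProject, Tag 04GG] -/
theorem exists_grpObj_isMonHom_of_subset
    (h1 : Set.range (η[G]).left ⊆ (V : Set G.left))
    (hi : Set.range (V.ι ≫ (ι[G]).left) ⊆ (V : Set G.left))
    (hm : Set.range (((Over.homMk V.ι : Over.mk (V.ι ≫ G.hom) ⟶ G) ⊗ₘ
        (Over.homMk V.ι : Over.mk (V.ι ≫ G.hom) ⟶ G)) ≫ μ[G]).left ⊆ (V : Set G.left)) :
    ∃ GV : GrpObj (Over.mk (V.ι ≫ G.hom)),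
      (letI := GV; IsMonHom (Over.homMk V.ι : Over.mk (V.ι ≫ G.hom) ⟶ G)) := by
  let j : Over.mk (V.ι ≫ G.hom) ⟶ G := Over.homMk V.ι
  have hrange : Set.range V.ι = (V : Set G.left) := V.range_ι
  -- unit
  let e₀ := IsOpenImmersion.lift V.ι (η[G]).left (by rw [hrange]; exact h1)
  have he₀ : e₀ ≫ V.ι = (η[G]).left := IsOpenImmersion.lift_fac _ _ _
  let eU : 𝟙_ (Over S) ⟶ Over.mk (V.ι ≫ G.hom) := Over.homMk e₀ (by
    change e₀ ≫ V.ι ≫ G.hom = _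
    rw [← Category.assoc, he₀]
    exact Over.w η[G])
  have he : eU ≫ j = η[G] := by
    ext : 1
    simpa [eU, j] using he₀
  -- inversion
  let i₀ := IsOpenImmersion.lift V.ι (V.ι ≫ (ι[G]).left) (by rw [hrange]; exact hi)
  have hi₀ : i₀ ≫ V.ι = V.ι ≫ (ι[G]).left := IsOpenImmersion.lift_fac _ _ _
  let iU : Over.mk (V.ι ≫ G.hom) ⟶ Over.mk (V.ι ≫ G.hom) := Over.homMk i₀ (by
    change i₀ ≫ V.ι ≫ G.hom = V.ι ≫ G.hom
    rw [← Category.assoc, hi₀, Category.assoc, Over.w ι[G]])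
  have hi' : iU ≫ j = j ≫ ι[G] := by
    ext : 1
    simpa [iU, j] using hi₀
  -- multiplication
  let m₀ := IsOpenImmersion.lift V.ι ((j ⊗ₘ j) ≫ μ[G]).left (by rw [hrange]; exact hm)
  have hm₀ : m₀ ≫ V.ι = ((j ⊗ₘ j) ≫ μ[G]).left := IsOpenImmersion.lift_fac _ _ _
  let mU : Over.mk (V.ι ≫ G.hom) ⊗ Over.mk (V.ι ≫ G.hom) ⟶ Over.mk (V.ι ≫ G.hom) := Over.homMk m₀ (by
    change m₀ ≫ V.ι ≫ G.hom = _
    rw [← Category.assoc, hm₀]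
    exact Over.w _)
  have hm' : mU ≫ j = (j ⊗ₘ j) ≫ μ[G] := by
    ext : 1
    simpa [mU, j] using hm₀
  haveI : Mono j := Over.mono_homMk _
  obtain ⟨GU, -, -, -, hmon⟩ := exists_grpObj_isMonHom_of_lifts j mU hm' eU he iU hi'
  exact ⟨GU, hmon⟩

end Opens

/-! ## §2 Topology: morphisms landing in a clopen through the unit point -/

section Topology

/-- A morphism from the spectrum of a LOCAL ring lands in every open subset containing the image of the closed point (every point
of `Spec R` specialises to the closed point, and open sets are stable under generisation). [cite: StacksProject, Tag 00EE] -/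
theorem range_subset_of_specializes {R : Type u} [CommRing R] [IsLocalRing R] {X : Scheme.{u}}
    (f : Spec (.of R) ⟶ X) (U : X.Opens) (h : f (IsLocalRing.closedPoint R) ∈ U) :
    Set.range f ⊆ (U : Set X) := by
  rintro _ ⟨x, rfl⟩
  exact ((IsLocalRing.specializes_closedPoint x).map f.continuous).mem_open U.isOpen h

/-- A morphism from a CONNECTED scheme lands in every clopen subset that it meets. [cite: StacksProject, Tag 00EE] -/
theorem range_subset_of_isClopen {W X : Scheme.{u}} [ConnectedSpace W] (g : W ⟶ X) {V : Set X} (hV : IsClopen V)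
    (w : W) (hw : g w ∈ V) : Set.range g ⊆ V :=
  (isConnected_range g.continuous).isPreconnected.subset_isClopen hV ⟨g w, ⟨w, rfl⟩, hw⟩

end Topology

/-! ## §3 A clopen basic open `D(e)` with local coordinate ring through the unit section (henselian base) -/

section Clopen

/-- **`D(e)` is open and closed for an idempotent global section `e`**: its complement is `D(1 - e)` (in the local ring `𝒪_{X,x}`
exactly one of the complementary idempotents `e_x`, `1 - e_x` is a unit). [cite: StacksProject, Tag 00EE] -/
theorem isClopen_basicOpen_of_isIdempotentElem {X : Scheme.{u}} (e : Γ(X, ⊤)) (he : IsIdempotentElem e) :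
    IsClopen (X.basicOpen e : Set X) := by
  have hcompl : (X.basicOpen e : Set X)ᶜ = (X.basicOpen (1 - e) : Set X) := by
    ext x
    simp only [Set.mem_compl_iff, SetLike.mem_coe, Scheme.mem_basicOpen_top, map_sub, map_one]
    have hex : IsIdempotentElem (X.presheaf.germ ⊤ x trivial e) := he.map _
    constructor
    · intro h
      exact (IsLocalRing.isUnit_or_isUnit_one_sub_self _).resolve_left h
    · intro h1 h2
      exact (h2.mul h1).ne_zero hex.mul_one_sub_self
  refine ⟨?_, (X.basicOpen e).isOpen⟩
  rw [← isOpen_compl_iff, hcompl]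
  exact (X.basicOpen (1 - e)).isOpen

/-- For a morphism `f : Spec R → X` from the spectrum of a local ring and a global section `s`, the closed point goes into `D(s)` iff
`f♯(s) ∈ R` is a unit (`f⁻¹ D(s) = D(f♯ s)`). [cite: StacksProject, Tag 00EE] -/
theorem closedPoint_mem_basicOpen_iff {R : Type u} [CommRing R] [IsLocalRing R] {X : Scheme.{u}}
    (f : Spec (.of R) ⟶ X) (s : Γ(X, ⊤)) :
    f (IsLocalRing.closedPoint R) ∈ X.basicOpen s ↔ IsUnit ((f.appTop ≫ (Scheme.ΓSpecIso (.of R)).hom).hom s) := by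
  change IsLocalRing.closedPoint R ∈ f ⁻¹ᵁ X.basicOpen s ↔ _
  rw [Scheme.preimage_basicOpen_top, basicOpen_eq_of_affine']
  change IsLocalRing.closedPoint R ∈ PrimeSpectrum.basicOpen _ ↔ _
  rw [PrimeSpectrum.mem_basicOpen]
  change _ ∉ IsLocalRing.maximalIdeal R ↔ _
  rw [IsLocalRing.mem_maximalIdeal, mem_nonunits_iff, not_not]
  rfl

/-- **The unit idempotent.**  For a group scheme `G` FINITE over a HENSELIAN local ring `R` there is an idempotent `e ∈ Γ(G, 𝒪_G)` such
that the unit section takes the closed point of `Spec R` into `D(e)` and the corner `Γ(G, 𝒪_G) ⧸ (1 - e)` is a LOCAL ring: `Γ(G, 𝒪_G)` is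
module-finite over `R`, hence has complete orthogonal idempotents with local corners (★ `Henselian.exists_completeOrthogonalIdempotents_isLocalRing`,
[StacksProject] 04GG (10)); their images under the counit `η♯ : Γ(G, 𝒪_G) → R` sum to `1`, so one of them is a unit of the local ring `R`.
[cite: Tate1997FiniteFlatGroupSchemes, (3.7) (I)] [cite: StacksProject, Tag 04GG] -/
theorem exists_isIdempotentElem {R : Type u} [CommRing R] [HenselianLocalRing R] (G : Over (Spec (.of R))) [GrpObj G]
    [IsFinite G.hom] :
    ∃ e : Γ(G.left, ⊤), IsIdempotentElem e ∧
      ((η[G]).left : Spec (.of R) ⟶ G.left) (IsLocalRing.closedPoint R) ∈ G.left.basicOpen e ∧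
      IsLocalRing (Γ(G.left, ⊤) ⧸ Ideal.span {1 - e}) := by
  letI alg : Algebra R Γ(G.left, ⊤) := ((Scheme.ΓSpecIso (.of R)).inv ≫ G.hom.appTop).hom.toAlgebra
  haveI : Module.Finite R Γ(G.left, ⊤) := by
    have h1 : G.hom.appTop.hom.Finite := G.hom.finite_appTop
    have h2 : (Scheme.ΓSpecIso (.of R)).inv.hom.Finite :=
      RingHom.Finite.of_surjective _ (Scheme.ΓSpecIso (.of R)).commRingCatIsoToRingEquiv.symm.surjective
    exact h1.comp h2
  obtain ⟨n, e, he, hloc⟩ :=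
    Literature.RingTheory.Henselian.exists_completeOrthogonalIdempotents_isLocalRing R (S := Γ(G.left, ⊤))
  set ε : Γ(G.left, ⊤) →+* R :=
    ((((η[G]).left : Spec (.of R) ⟶ G.left)).appTop ≫ (Scheme.ΓSpecIso (.of R)).hom).hom with hε
  have hsum : ∑ i, ε (e i) = 1 := by rw [← map_sum, he.complete, map_one]
  obtain ⟨i, hi⟩ : ∃ i, IsUnit (ε (e i)) := by
    by_contra h
    simp only [not_exists] at h
    have hmem : ∑ i, ε (e i) ∈ IsLocalRing.maximalIdeal R :=
      Ideal.sum_mem _ fun i _ => (IsLocalRing.mem_maximalIdeal _).mpr (h i)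
    rw [hsum] at hmem
    exact (IsLocalRing.maximalIdeal.isMaximal R).ne_top (Ideal.eq_top_of_isUnit_mem _ hmem isUnit_one)
  exact ⟨e i, he.idem i, (closedPoint_mem_basicOpen_iff _ (e i)).mpr hi, hloc i⟩

end Clopen

/-! ## §4 The coordinate ring of `D(e)` is the local corner; `D(e)` and `D(e) ×_R D(e)` are connected -/

section LocalCorner

variable {X : Scheme.{u}} [IsAffine X] (e : Γ(X, ⊤)) (he : IsIdempotentElem e)
  (hloc : IsLocalRing (Γ(X, ⊤) ⧸ Ideal.span {1 - e}))

include he in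
/-- For an idempotent global section `e` of an affine scheme, the restriction `Γ(X, 𝒪) → Γ(X, D(e))` is surjective (both `Γ(X, D(e))`
and `Γ(X, 𝒪) ⧸ (1 - e)` are the localisation at `e`). [cite: StacksProject, Tag 00EE] -/
theorem surjective_algebraMap_basicOpen :
    Function.Surjective (algebraMap Γ(X, ⊤) Γ(X, X.basicOpen e)) := by
  haveI : IsLocalization.Away e (Γ(X, ⊤) ⧸ Ideal.span {1 - e}) :=
    IsLocalization.away_of_isIdempotentElem he Ideal.mk_ker Ideal.Quotient.mk_surjective
  let φ := IsLocalization.algEquiv (Submonoid.powers e) (Γ(X, ⊤) ⧸ Ideal.span {1 - e}) Γ(X, X.basicOpen e)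
  intro t
  obtain ⟨q, hq⟩ := φ.surjective t
  obtain ⟨s, rfl⟩ := Ideal.Quotient.mk_surjective q
  exact ⟨s, by rw [← hq, ← Ideal.Quotient.algebraMap_eq, AlgEquiv.commutes]⟩

include he hloc in
/-- If the corner `Γ(X, 𝒪) ⧸ (1 - e)` at an idempotent `e` of an affine scheme is local, so is `Γ(X, D(e))` (the two are isomorphic
localisations at `e`). [cite: StacksProject, Tag 00EE] -/
theorem isLocalRing_sections_basicOpen : IsLocalRing Γ(X, X.basicOpen e) := by
  haveI : IsLocalization.Away e (Γ(X, ⊤) ⧸ Ideal.span {1 - e}) :=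
    IsLocalization.away_of_isIdempotentElem he Ideal.mk_ker Ideal.Quotient.mk_surjective
  haveI := hloc
  let φ := IsLocalization.algEquiv (Submonoid.powers e) (Γ(X, ⊤) ⧸ Ideal.span {1 - e}) Γ(X, X.basicOpen e)
  haveI : Nontrivial Γ(X, X.basicOpen e) := φ.injective.nontrivial
  exact IsLocalRing.of_surjective' φ.toRingHom φ.surjective

include he hloc in
/-- The same for the global sections of the open subscheme `D(e)` (Mathlib `Scheme.Opens.topIso`). [cite: StacksProject, Tag 00EE] -/
theorem isLocalRing_Γ_basicOpen : IsLocalRing Γ((X.basicOpen e : Scheme.{u}), ⊤) := by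
  haveI := isLocalRing_sections_basicOpen e he hloc
  haveI : Nontrivial Γ((X.basicOpen e : Scheme.{u}), ⊤) :=
    (X.basicOpen e).topIso.commRingCatIsoToRingEquiv.symm.injective.nontrivial
  exact IsLocalRing.of_surjective' (X.basicOpen e).topIso.inv.hom
    (X.basicOpen e).topIso.commRingCatIsoToRingEquiv.symm.surjective

include he hloc in
/-- **`D(e)` is connected** when the corner `Γ(X, 𝒪) ⧸ (1 - e)` is local: the open subscheme `D(e)` is affine with local coordinate ring,
and the spectrum of a local ring is connected (★ `Morphisms.connectedSpace_Spec_of_isLocalRing`).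
[cite: Tate1997FiniteFlatGroupSchemes, (3.7) (I)] [cite: StacksProject, Tag 04GG] -/
theorem connectedSpace_basicOpen : ConnectedSpace ↥(X.basicOpen e : Scheme.{u}) := by
  haveI : IsAffine (X.basicOpen e : Scheme.{u}) := (isAffineOpen_top X).basicOpen e
  haveI := isLocalRing_Γ_basicOpen e he hloc
  haveI := Literature.AlgebraicGeometry.Morphisms.connectedSpace_Spec_of_isLocalRing
    (Γ((X.basicOpen e : Scheme.{u}), ⊤) : Type u)
  exact (X.basicOpen e : Scheme.{u}).isoSpec.inv.homeomorph.surjective.connectedSpace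
    (X.basicOpen e : Scheme.{u}).isoSpec.inv.continuous

end LocalCorner

section Product

variable {R : Type u} [CommRing R] (G : Over (Spec (.of R))) [GrpObj G]

omit [GrpObj G] in
/-- `Γ(G, 𝒪_G)` is module-finite over `R` through `R ≅ Γ(Spec R) → Γ(G)` when `G → Spec R` is finite (Mathlib `Scheme.Hom.finite_appTop`).
[cite: StacksProject, Tag 04GG] -/
theorem finite_ΓSpecIso_inv_comp_appTop [IsFinite G.hom] :
    ((Scheme.ΓSpecIso (.of R)).inv ≫ G.hom.appTop).hom.Finite := by
  have h1 : G.hom.appTop.hom.Finite := G.hom.finite_appTop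
  have h2 : (Scheme.ΓSpecIso (.of R)).inv.hom.Finite :=
    RingHom.Finite.of_surjective _ (Scheme.ΓSpecIso (.of R)).commRingCatIsoToRingEquiv.symm.surjective
  exact h1.comp h2

omit [GrpObj G] in
/-- An affine open `V` of an `R`-scheme `G` maps to `Spec R` through `V ≅ Spec Γ(V)` and `Spec` of its structure map `R → Γ(V)`
(Mathlib `Scheme.isoSpec_inv_naturality`). [cite: StacksProject, Tag 04GG] -/
theorem eq_isoSpec_hom_comp (V : G.left.Opens) (hV : IsAffineOpen V) :
    haveI : IsAffine (V : Scheme.{u}) := hV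
    V.ι ≫ G.hom = (V : Scheme.{u}).isoSpec.hom ≫
      Spec.map ((Scheme.ΓSpecIso (.of R)).inv ≫ (V.ι ≫ G.hom).appTop) := by
  haveI : IsAffine (V : Scheme.{u}) := hV
  rw [Spec.map_comp, ← Scheme.isoSpec_Spec_inv, Scheme.isoSpec_inv_naturality, Iso.hom_inv_id_assoc]

/-- **`D(e) ×_R D(e)` is connected** ([Tate1997FiniteFlatGroupSchemes] (3.7) (I), proof, item 2)).  For a group scheme `G` finite over a local ring `R` and an idempotent `e ∈ Γ(G, 𝒪_G)`
with local corner such that the unit section passes through `D(e)`: the fibre product `D(e) ×_{Spec R} D(e)` is connected.  Indeed it is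
`Spec (Γ(D(e)) ⊗_R Γ(D(e)))` (Mathlib `pullbackSpecIso`), `Γ(D(e))` is a module-finite local `R`-algebra whose residue field is generated by
`R` (the unit section gives a retraction `Γ(D(e)) → R`), and such a tensor product is local (★ `Henselian.isLocalRing_tensorProduct`),
non-trivial thanks to `η ⊗ η`. [cite: Tate1997FiniteFlatGroupSchemes, (3.7) (I), proof, item 2) (pp. 141–142)] [cite: StacksProject, Tag 04GG] -/
theorem connectedSpace_pullback [IsLocalRing R] [IsFinite G.hom] (e : Γ(G.left, ⊤)) (he : IsIdempotentElem e)
    (hloc : IsLocalRing (Γ(G.left, ⊤) ⧸ Ideal.span {1 - e}))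
    (hη : ((η[G]).left : Spec (.of R) ⟶ G.left) (IsLocalRing.closedPoint R) ∈ G.left.basicOpen e) :
    ConnectedSpace ↥(pullback ((G.left.basicOpen e).ι ≫ G.hom) ((G.left.basicOpen e).ι ≫ G.hom)) := by
  haveI : IsAffine G.left := isAffine_of_isAffineHom G.hom
  haveI hVaff : IsAffine (G.left.basicOpen e : Scheme.{u}) := (isAffineOpen_top G.left).basicOpen e
  -- the coordinate rings `S = Γ(G)` and `S₀ = Γ(D(e))` as `R`-algebras
  letI algS : Algebra R Γ(G.left, ⊤) := ((Scheme.ΓSpecIso (.of R)).inv ≫ G.hom.appTop).hom.toAlgebra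
  letI algS₀ : Algebra R Γ((G.left.basicOpen e : Scheme.{u}), ⊤) :=
    ((Scheme.ΓSpecIso (.of R)).inv ≫ ((G.left.basicOpen e).ι ≫ G.hom).appTop).hom.toAlgebra
  haveI : Module.Finite R Γ(G.left, ⊤) := finite_ΓSpecIso_inv_comp_appTop G
  haveI : IsLocalRing Γ((G.left.basicOpen e : Scheme.{u}), ⊤) := isLocalRing_Γ_basicOpen e he hloc
  -- `S → S₀` is surjective
  have hres : Function.Surjective (G.left.basicOpen e).ι.appTop := by
    have h1 : (G.left.basicOpen e).ι.appTop ≫ (G.left.basicOpen e).topIso.hom =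
        CommRingCat.ofHom (algebraMap Γ(G.left, ⊤) Γ(G.left, G.left.basicOpen e)) := by
      rw [Scheme.Opens.ι_appTop, Scheme.Opens.topIso_hom, ← Functor.map_comp]
      rfl
    intro t
    obtain ⟨s, hs⟩ := surjective_algebraMap_basicOpen e he ((G.left.basicOpen e).topIso.hom t)
    refine ⟨s, (G.left.basicOpen e).topIso.commRingCatIsoToRingEquiv.injective ?_⟩
    change ((G.left.basicOpen e).ι.appTop ≫ (G.left.basicOpen e).topIso.hom) s = _
    rw [h1]
    exact hs
  let ψ : Γ(G.left, ⊤) →ₐ[R] Γ((G.left.basicOpen e : Scheme.{u}), ⊤) :=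
    { (G.left.basicOpen e).ι.appTop.hom with
      commutes' := fun r => by
        change (G.hom.appTop ≫ (G.left.basicOpen e).ι.appTop) ((Scheme.ΓSpecIso (.of R)).inv r) =
          (((G.left.basicOpen e).ι ≫ G.hom).appTop) ((Scheme.ΓSpecIso (.of R)).inv r)
        rfl }
  haveI : Module.Finite R Γ((G.left.basicOpen e : Scheme.{u}), ⊤) := Module.Finite.of_surjective ψ.toLinearMap hres
  -- the section `ε₀ : S₀ → R` through the unit
  have hrange : Set.range (G.left.basicOpen e).ι = (G.left.basicOpen e : Set G.left) := (G.left.basicOpen e).range_ι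
  let η₀ := IsOpenImmersion.lift (G.left.basicOpen e).ι ((η[G]).left : Spec (.of R) ⟶ G.left)
    (by rw [hrange]; exact range_subset_of_specializes _ _ hη)
  have hη₀ : η₀ ≫ (G.left.basicOpen e).ι = (η[G]).left := IsOpenImmersion.lift_fac _ _ _
  let ε₀ : Γ((G.left.basicOpen e : Scheme.{u}), ⊤) →+* R := (η₀.appTop ≫ (Scheme.ΓSpecIso (.of R)).hom).hom
  have hcomp : ((G.left.basicOpen e).ι ≫ G.hom).appTop ≫ η₀.appTop = 𝟙 _ := by
    rw [← Scheme.Hom.comp_appTop, ← Category.assoc, hη₀, Over.w η[G]]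
    exact Scheme.Hom.id_appTop
  have hε₀ : ∀ r : R, ε₀ (algebraMap R _ r) = r := fun r => by
    change (((Scheme.ΓSpecIso (.of R)).inv ≫ ((G.left.basicOpen e).ι ≫ G.hom).appTop) ≫ η₀.appTop ≫
      (Scheme.ΓSpecIso (.of R)).hom) r = r
    rw [Category.assoc, ← Category.assoc (((G.left.basicOpen e).ι ≫ G.hom).appTop), hcomp, Category.id_comp,
      Iso.inv_hom_id]
    rfl
  have hA : ∀ a : Γ((G.left.basicOpen e : Scheme.{u}), ⊤), ∃ r : R,
      a - algebraMap R _ r ∈ IsLocalRing.maximalIdeal _ := fun a =>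
    ⟨ε₀ a, IsLocalRing.le_maximalIdeal (RingHom.ker_ne_top ε₀) (by rw [RingHom.mem_ker, map_sub, hε₀, sub_self])⟩
  let ε₀' : Γ((G.left.basicOpen e : Scheme.{u}), ⊤) →ₐ[R] R := { ε₀ with commutes' := hε₀ }
  haveI : Nontrivial (Γ((G.left.basicOpen e : Scheme.{u}), ⊤) ⊗[R] Γ((G.left.basicOpen e : Scheme.{u}), ⊤)) :=
    (Algebra.TensorProduct.lift ε₀' ε₀' fun _ _ => Commute.all _ _).toRingHom.domain_nontrivial
  haveI : IsLocalRing (Γ((G.left.basicOpen e : Scheme.{u}), ⊤) ⊗[R] Γ((G.left.basicOpen e : Scheme.{u}), ⊤)) :=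
    Literature.RingTheory.Henselian.isLocalRing_tensorProduct hA
  haveI := Literature.AlgebraicGeometry.Morphisms.connectedSpace_Spec_of_isLocalRing
    (Γ((G.left.basicOpen e : Scheme.{u}), ⊤) ⊗[R] Γ((G.left.basicOpen e : Scheme.{u}), ⊤))
  -- the identification `D(e) ×_R D(e) ≅ Spec (S₀ ⊗ S₀)`
  have hfac := eq_isoSpec_hom_comp G (G.left.basicOpen e) ((isAffineOpen_top G.left).basicOpen e)
  let w := pullback.map ((G.left.basicOpen e).ι ≫ G.hom) ((G.left.basicOpen e).ι ≫ G.hom)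
    (Spec.map (CommRingCat.ofHom (algebraMap R Γ((G.left.basicOpen e : Scheme.{u}), ⊤))))
    (Spec.map (CommRingCat.ofHom (algebraMap R Γ((G.left.basicOpen e : Scheme.{u}), ⊤))))
    (G.left.basicOpen e : Scheme.{u}).isoSpec.hom (G.left.basicOpen e : Scheme.{u}).isoSpec.hom (𝟙 _)
    (by rw [Category.comp_id, hfac]; rfl) (by rw [Category.comp_id, hfac]; rfl)
  let I := asIso w ≪≫ pullbackSpecIso R _ _
  exact I.inv.homeomorph.surjective.connectedSpace I.inv.continuous

end Product

/-! ## §5 The unit component: existence over a henselian local base -/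

section Main

/-- **The unit component of a finite group scheme over a henselian local ring** ([Tate1997FiniteFlatGroupSchemes] (3.7) (I), «`G⁰`»)
— the statement of stub `stub_b1a_unitComponent` of `Lines/F0_P6b_ConnectedEtale.lean` ED. 1 with `IsUnitComponent` unfolded binder for
binder: for `G` a group object of `Over (Spec R)` with `G → Spec R` FINITE and `R` henselian local (no flatness), there are a group
object `G₀` of `Over (Spec R)` and a homomorphism `j : G₀ ⟶ G` whose underlying morphism of schemes is an OPEN and CLOSED IMMERSION with
CONNECTED source.  Construction: `G₀ = D(e) → Spec R` for the unit idempotent `e` (§3), `j = D(e) ↪ G`; the group structure is §1, its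
three set-theoretic hypotheses holding because `Spec R`, `D(e)` and `D(e) ×_R D(e)` are connected (§2, §4) and pass through the unit point.
[cite: Tate1997FiniteFlatGroupSchemes, (3.7) (I)] [cite: StacksProject, Tag 04GG] -/
theorem exists_unitComponent (R : Type u) [CommRing R] [HenselianLocalRing R] (G : Over (Spec (.of R))) [GrpObj G]
    (hG : IsFinite G.hom) :
    ∃ (G₀ : Over (Spec (.of R))) (_ : GrpObj G₀) (j : G₀ ⟶ G),
      IsMonHom j ∧ IsOpenImmersion j.left ∧ IsClosedImmersion j.left ∧ ConnectedSpace ↥G₀.left := by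
  haveI : IsAffine G.left := isAffine_of_isAffineHom G.hom
  obtain ⟨e, he, hη, hloc⟩ := exists_isIdempotentElem G
  have hclopen : IsClopen (G.left.basicOpen e : Set G.left) := isClopen_basicOpen_of_isIdempotentElem e he
  haveI hVconn : ConnectedSpace ↥(G.left.basicOpen e : Scheme.{u}) := connectedSpace_basicOpen e he hloc
  haveI hWconn : ConnectedSpace
      ↥((Over.mk ((G.left.basicOpen e).ι ≫ G.hom) ⊗ Over.mk ((G.left.basicOpen e).ι ≫ G.hom)).left) :=
    connectedSpace_pullback G e he hloc hη
  have hrange : Set.range (G.left.basicOpen e).ι = (G.left.basicOpen e : Set G.left) := (G.left.basicOpen e).range_ι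
  -- the unit lands in `D(e)`
  have h1 : Set.range ((η[G]).left : Spec (.of R) ⟶ G.left) ⊆ (G.left.basicOpen e : Set G.left) :=
    range_subset_of_specializes _ _ hη
  -- the section through `D(e)`
  let η₀ := IsOpenImmersion.lift (G.left.basicOpen e).ι ((η[G]).left : Spec (.of R) ⟶ G.left)
    (by rw [hrange]; exact h1)
  have hη₀ : η₀ ≫ (G.left.basicOpen e).ι = (η[G]).left := IsOpenImmersion.lift_fac _ _ _
  -- the inversion preserves `D(e)`
  have hi : Set.range ((G.left.basicOpen e).ι ≫ (ι[G]).left) ⊆ (G.left.basicOpen e : Set G.left) := by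
    refine range_subset_of_isClopen _ hclopen (η₀ (IsLocalRing.closedPoint R)) ?_
    rw [← Scheme.Hom.comp_apply, ← Category.assoc, hη₀, ← Over.comp_left, GrpObj.one_inv]
    exact hη
  -- the multiplication preserves `D(e)`
  have hm : Set.range (((Over.homMk (G.left.basicOpen e).ι : Over.mk ((G.left.basicOpen e).ι ≫ G.hom) ⟶ G) ⊗ₘ
      (Over.homMk (G.left.basicOpen e).ι : Over.mk ((G.left.basicOpen e).ι ≫ G.hom) ⟶ G)) ≫ μ[G]).left ⊆
        (G.left.basicOpen e : Set G.left) := by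
    let η₀' : 𝟙_ (Over (Spec (.of R))) ⟶ Over.mk ((G.left.basicOpen e).ι ≫ G.hom) := Over.homMk η₀ (by
      change η₀ ≫ (G.left.basicOpen e).ι ≫ G.hom = _
      rw [← Category.assoc, hη₀]
      exact Over.w η[G])
    have hj : η₀' ≫ Over.homMk (G.left.basicOpen e).ι = η[G] := by
      ext : 1
      simpa [η₀'] using hη₀
    refine range_subset_of_isClopen _ hclopen ((lift η₀' η₀').left (IsLocalRing.closedPoint R)) ?_
    rw [← Scheme.Hom.comp_apply, ← Over.comp_left, lift_map_assoc, hj]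
    have hmul : lift η[G] η[G] ≫ μ[G] = η[G] := by
      have := lift_toUnit_one_comp_mul (X := G) (η[G])
      rwa [toUnit_unit, Category.id_comp] at this
    rw [hmul]
    exact hη
  obtain ⟨GV, hmon⟩ := exists_grpObj_isMonHom_of_subset G (G.left.basicOpen e) h1 hi hm
  refine ⟨Over.mk ((G.left.basicOpen e).ι ≫ G.hom), GV, Over.homMk (G.left.basicOpen e).ι, hmon, ?_, ?_, hVconn⟩
  · change IsOpenImmersion (G.left.basicOpen e).ι
    infer_instance
  · change IsClosedImmersion (G.left.basicOpen e).ι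
    exact IsClosedImmersion.of_isPreimmersion _ (by rw [hrange]; exact hclopen.1)

end Main

end Literature.AlgebraicGeometry.GroupSchemes.UnitComponentClopen

end
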